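import Summits.Ventures.SP4Inv.RibbonCertificates

/-!
# Kernel replay of `kirby-cert/1` RIBBON certificates, I: PD states, faces, `R1-`, `PASS` (venture SP4Inv)

Honest framing (cell `pub-sp4inv`, seat p3 gen 3, HOME `run/shared/lean/pub/pub-sp4inv/`): the cell's
ribbon certificates (`HOME/p3/CERT-FORMAT-kirby.md`; a PD code, orientation-coherent band moves and
Reidemeister-level isotopies `R1-`/`PASS`/`FLOAT`/`REVERSE` ending at a crossingless unlink) have so far
entered Lean only through the EXTERNAL-replay hypothesis `ReplaySound` of `RibbonCertificates`
("an independent program accepted every step").  This file and its sequel `KernelReplay` remove the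
program from that sentence: they DEFINE, inside Lean, deterministic PD-code semantics of the five ribbon
moves and the decidable acceptance predicate `KR.KCert.check`, so that a certificate is ACCEPTED BY THE
KERNEL (`decide`).  What remains a named hypothesis is exactly `KR.Sound` (in the sequel): that the move
semantics written here ARE ambient isotopies / saddles of the link a PD code presents.  Nothing in this
file asserts that any particular diagram presents any particular knot; nothing here is a claim about `S⁴`.

THIS FILE: oriented PD states with crossing signs (§1), darts and face walks with the two univalent ends
of a cut-open arc (§2), deletion of crossings with merging of the surviving strands (§3), and the two
isotopy moves that need them (§4): `R1-` (kink removal) and `PASS` = replace an arc lying entirely above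
(resp. below) the rest — monotone discipline: a crossing met once has the arc as the over (resp. under)
strand, a self-crossing has the LATER passage on top (resp. below), so the arc has monotone height and is
unknotted rel endpoints — by the arc that leaves the cut point `P`, crosses the listed darts in order as
the over (resp. under) strand, each dart on the boundary of the face currently containing the tip, and is
sealed at `Q` in the tip's final face (two unknotted arcs above the rest with the same endpoints are
isotopic rel the rest; `R2`/`R3` are special cases).

Conventions (= the cell's reference implementation `HOME/p3/kirby/kmoves.py`, label for label; a Python
twin `kreplay.py` of these files translates the cell's certificates into this labelling): a crossing is
`⟨s0, s1, s2, s3, pos⟩` = KnotInfo PD slots counter-clockwise, `s0` the under strand coming IN, `s2` the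
under strand going OUT, `pos = true` iff the over strand comes in at `s3` (positive crossing); slot `k`
is the HEAD end of its edge iff `k = 0`, or `k = 1 ∧ ¬pos`, or `k = 3 ∧ pos`.  Darts `(e, fwd)`; after
arriving at a crossing through slot `k` a face boundary leaves through slot `k + 1 (mod 4)`, so faces lie
to the RIGHT of their darts; at a univalent end (`P` = head end of the growing arc, `Q` = tail end of the
arc's continuation) the boundary walk turns back.  Fresh edge labels come from a counter (`fresh`), new
crossings are appended, deleted crossings keep the order of the rest, and a merged edge keeps the label
of its first part — these choices only fix LABELS and are mirrored by the twin.  Disconnected blocks of a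
diagram are split sublinks; face walks never leave a block, which is conservative and sound.

References: K. Reidemeister, *Knotentheorie* (1932) (the moves); R. E. Gompf, A. I. Stipsicz,
*4-Manifolds and Kirby Calculus* (1999) §6.2; cell spec `HOME/p3/CERT-FORMAT-kirby.md` §1–§3.
-/

namespace Summit.Ventures.SP4Inv.KR

/-! ## 1. Oriented PD states -/

/-- One crossing of an oriented PD code: slots `s0..s3` counter-clockwise (KnotInfo: `s0` = under strand
in, `s2` = under strand out) and `pos` = the over strand comes in at `s3`. [folklore] -/
structure Xg where
  /-- slot 0: under strand, incoming edge label -/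
  s0 : ℕ
  /-- slot 1 (over strand) -/
  s1 : ℕ
  /-- slot 2: under strand, outgoing edge label -/
  s2 : ℕ
  /-- slot 3 (over strand) -/
  s3 : ℕ
  /-- positive crossing: the over strand comes IN at slot 3 -/
  pos : Bool
  deriving DecidableEq, Repr, Inhabited

namespace Xg

/-- Label at slot `k` (any `k ≥ 3` reads slot 3). [folklore] -/
def lab (x : Xg) (k : ℕ) : ℕ :=
  if k = 0 then x.s0 else if k = 1 then x.s1 else if k = 2 then x.s2 else x.s3

/-- Is slot `k` the HEAD end of the edge it carries? [folklore] -/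
def isHead (x : Xg) (k : ℕ) : Bool :=
  if k = 0 then true else if k = 1 then !x.pos else if k = 2 then false else x.pos

/-- Overwrite the label at slot `k`. [folklore] -/
def setLab (x : Xg) (k e : ℕ) : Xg :=
  if k = 0 then { x with s0 := e } else if k = 1 then { x with s1 := e }
  else if k = 2 then { x with s2 := e } else { x with s3 := e }

/-- The slot (scanning `0,1,2,3`) at which label `e` has an end of the requested kind
(`head = true`: its head), if any. [folklore] -/
def slotOf (x : Xg) (e : ℕ) (head : Bool) : Option ℕ :=
  if x.s0 = e ∧ head = true then some 0
  else if x.s1 = e ∧ (!x.pos) = head then some 1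
  else if x.s2 = e ∧ head = false then some 2
  else if x.s3 = e ∧ x.pos = head then some 3 else none

/-- Rename label `old` to `new` in all four slots. [folklore] -/
def relab (x : Xg) (old new : ℕ) : Xg :=
  ⟨if x.s0 = old then new else x.s0, if x.s1 = old then new else x.s1,
   if x.s2 = old then new else x.s2, if x.s3 = old then new else x.s3, x.pos⟩

/-- Number of slots carrying label `e`. [folklore] -/
def count (x : Xg) (e : ℕ) : ℕ :=
  (if x.s0 = e then 1 else 0) + (if x.s1 = e then 1 else 0) +
    (if x.s2 = e then 1 else 0) + (if x.s3 = e then 1 else 0)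

end Xg

/-- A replay state: the crossings, the number of crossingless (loose) circles, and the next unused
edge label. [folklore] -/
structure St where
  /-- crossings, in order -/
  xs : List Xg
  /-- number of crossingless circles -/
  loose : ℕ
  /-- next fresh edge label -/
  fresh : ℕ
  deriving DecidableEq, Repr, Inhabited

/-- First `(index, slot, crossing)` (in list order, slots `0..3`) where label `e` has its head
(`head = true`) or tail (`head = false`); `i` is the running index. [folklore] -/
def findEnd : List Xg → ℕ → Bool → ℕ → Option (ℕ × ℕ × Xg)
  | [], _, _, _ => none
  | x :: xs, e, head, i =>
    match x.slotOf e head with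
    | some k => some (i, k, x)
    | none => findEnd xs e head (i + 1)

/-- Overwrite slot `k` of the `i`-th crossing. [folklore] -/
def setSlot : List Xg → ℕ → ℕ → ℕ → List Xg
  | [], _, _, _ => []
  | x :: xs, 0, k, e => x.setLab k e :: xs
  | x :: xs, i + 1, k, e => x :: setSlot xs i k e

/-- Rename a label everywhere. [folklore] -/
def relabelAll (xs : List Xg) (old new : ℕ) : List Xg := xs.map fun x => x.relab old new

/-- Delete the crossings whose indices are listed (order of the rest kept); `i` is the running index.
[folklore] -/
def removeIdxs : List Xg → ℕ → List ℕ → List Xg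
  | [], _, _ => []
  | x :: xs, i, ds => if ds.any (· == i) then removeIdxs xs (i + 1) ds else x :: removeIdxs xs (i + 1) ds

/-- Total number of slots carrying label `e`. [folklore] -/
def countLab (xs : List Xg) (e : ℕ) : ℕ := xs.foldl (fun n x => n + x.count e) 0

/-- The edge following `e` along its component (the label opposite `e`'s head slot). [folklore] -/
def nextEdge (xs : List Xg) (e : ℕ) : Option ℕ :=
  match findEnd xs e true 0 with
  | some (_, k, x) => some (x.lab ((k + 2) % 4))
  | none => none

/-- Traversal worker for `componentEdges` (fuel-bounded). [folklore] -/
def compGo (xs : List Xg) (e0 : ℕ) : ℕ → ℕ → List ℕ → Option (List ℕ)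
  | 0, _, _ => none
  | fuel + 1, cur, acc =>
    match nextEdge xs cur with
    | none => none
    | some nx => if nx = e0 then some acc.reverse else compGo xs e0 fuel nx (nx :: acc)

/-- The edge labels of the component of `e`, in traversal order starting at `e`. [folklore] -/
def componentEdges (xs : List Xg) (e : ℕ) : Option (List ℕ) :=
  compGo xs e (4 * xs.length + 4) e [e]

/-- A diagram with `n ≥ 1` crossings is ONE component iff the component of any edge has all `2n`
edges. [folklore] -/
def isKnot (xs : List Xg) : Bool :=
  match xs with
  | [] => false
  | x :: _ =>
    match componentEdges xs x.s0 with
    | some c => c.length == 2 * xs.length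
    | none => false

/-! ## 2. Darts and faces (with the two univalent ends of a cut-open arc) -/

/-- Next dart along the boundary of the face to the RIGHT of dart `d = (e, fwd)`; `pe` = the label
whose head is the end vertex `P`, `qe` = the label whose tail is the end vertex `Q` (both `none` in a
closed diagram): arriving at an end vertex the walk turns back, arriving at a crossing through slot `k`
it leaves through slot `k + 1 (mod 4)`. [folklore] -/
def nextDart (xs : List Xg) (pe qe : Option ℕ) (d : ℕ × Bool) : Option (ℕ × Bool) :=
  if d.2 = true ∧ pe = some d.1 then some (d.1, false)
  else if d.2 = false ∧ qe = some d.1 then some (d.1, true)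
  else
    match findEnd xs d.1 d.2 0 with
    | none => none
    | some (_, k, x) => some (x.lab ((k + 1) % 4), !x.isHead ((k + 1) % 4))

/-- Face-walk worker: does the walk from `cur` reach `target` before returning to `start`? [folklore] -/
def orbitGo (xs : List Xg) (pe qe : Option ℕ) (start target : ℕ × Bool) : ℕ → ℕ × Bool → Bool
  | 0, _ => false
  | fuel + 1, cur =>
    match nextDart xs pe qe cur with
    | none => false
    | some nx => if nx = target then true else if nx = start then false
        else orbitGo xs pe qe start target fuel nx

/-- Do darts `d1`, `d2` lie on (the boundary of) one face? [folklore] -/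
def sameFace (xs : List Xg) (pe qe : Option ℕ) (d1 d2 : ℕ × Bool) : Bool :=
  if d1 = d2 then true else orbitGo xs pe qe d1 d2 (8 * xs.length + 8) d1

/-! ## 3. Deleting crossings and merging the surviving strands -/

/-- Which strand of a deleted crossing survives (its in-edge and out-edge are merged, the in-edge's label
kept): the under (`lower`) strand, the over (`upper`) strand, or neither. [folklore] -/
inductive Keep where
  | lower
  | upper
  | neither
  deriving DecidableEq, Repr

/-- The `(in, out)` label pair of the surviving strand of `x`. [folklore] -/
def pairOf (x : Xg) : Keep → Option (ℕ × ℕ)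
  | .lower => some (x.s0, x.s2)
  | .upper => if x.pos then some (x.s3, x.s1) else some (x.s1, x.s3)
  | .neither => none

/-- Apply a chronological list of renamings `(old, new)` to a label. [folklore] -/
def applyRen : List (ℕ × ℕ) → ℕ → ℕ
  | [], e => e
  | (v, u) :: r, e => applyRen r (if e = v then u else e)

/-- Merge worker: process the `(in, out)` pairs in order (earlier renamings applied first), renaming
`out ↦ in` everywhere (the two tracked labels included); a pair with `in = out` is a loop through deleted
crossings only, i.e. a component that has become a loose circle. Returns `(crossings, new loose circles,
tracked₁, tracked₂)`. [folklore] -/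
def mergeGo : List (ℕ × ℕ) → List (ℕ × ℕ) → List Xg → ℕ → ℕ → ℕ → List Xg × ℕ × ℕ × ℕ
  | [], _, xs, li, t1, t2 => (xs, li, t1, t2)
  | (u0, v0) :: rest, ren, xs, li, t1, t2 =>
    let u := applyRen ren u0
    let v := applyRen ren v0
    if u = v then mergeGo rest ren xs (li + 1) t1 t2
    else mergeGo rest (ren ++ [(v, u)]) (relabelAll xs v u) li (if t1 = v then u else t1)
      (if t2 = v then u else t2)

/-- Delete the listed crossings (indices into `xs`), merging the surviving strands; `t1, t2` are two
labels to track through the renamings. [folklore] -/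
def deleteCrossings (xs : List Xg) (dels : List (ℕ × Keep)) (t1 t2 : ℕ) :
    List Xg × ℕ × ℕ × ℕ :=
  let pairs := dels.filterMap fun d => (xs[d.1]?).bind fun x => pairOf x d.2
  mergeGo pairs [] (removeIdxs xs 0 (dels.map Prod.fst)) 0 t1 t2

/-! ## 4. The five ribbon moves -/

/-- `R1-` at crossing index `i`: two cyclically adjacent slots carry one label (a kink); delete it,
merging the other two slots' edges (or, if those coincide, the component becomes loose). [folklore] -/
def r1m (st : St) (i : ℕ) : Option St :=
  match st.xs[i]? with
  | none => none
  | some x =>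
    let ko : Option ℕ :=
      if x.s0 = x.s1 then some 0 else if x.s1 = x.s2 then some 1
      else if x.s2 = x.s3 then some 2 else if x.s3 = x.s0 then some 3 else none
    match ko with
    | none => none
    | some k =>
      let o1 := (k + 2) % 4
      let o2 := (k + 3) % 4
      if x.isHead o1 = x.isHead o2 then none
      else
        let fin := if x.isHead o1 then x.lab o1 else x.lab o2
        let fout := if x.isHead o1 then x.lab o2 else x.lab o1
        let rest := removeIdxs st.xs 0 [i]
        if fin = fout then some ⟨rest, st.loose + 1, st.fresh⟩
        else some ⟨relabelAll rest fout fin, st.loose, st.fresh⟩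

/-- Arc worker: the passages `(crossing index, entry slot)` strictly between edge `es` and edge `et`
along their component. [folklore] -/
def arcGo (xs : List Xg) (es et : ℕ) : ℕ → ℕ → List (ℕ × ℕ) → Option (List (ℕ × ℕ))
  | 0, _, _ => none
  | fuel + 1, cur, acc =>
    match findEnd xs cur true 0 with
    | none => none
    | some (i, k, x) =>
      let nx := x.lab ((k + 2) % 4)
      if nx = et then some ((i, k) :: acc).reverse
      else if nx = es then none else arcGo xs es et fuel nx ((i, k) :: acc)

/-- The passages strictly between `es` and `et` (`es = et`: the empty arc). [folklore] -/
def arcBetween (xs : List Xg) (es et : ℕ) : Option (List (ℕ × ℕ)) :=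
  if es = et then some [] else arcGo xs es et (4 * xs.length + 4) es []

/-- Occurrences of `i` in a list of indices. [folklore] -/
def countIdx (l : List ℕ) (i : ℕ) : ℕ := l.foldl (fun a j => if j = i then a + 1 else a) 0

/-- Position of the first occurrence of `i` (length if absent). [folklore] -/
def firstIdx : List ℕ → ℕ → ℕ
  | [], _ => 0
  | j :: l, i => if j = i then 0 else firstIdx l i + 1

/-- Monotone-arc discipline for cutting an arc in mode `over`: a crossing met once must have the arc as
the `over` (resp. under) strand; a crossing met twice is a self-crossing of the arc and the LATER
passage must be the `over` (resp. under) one; `n` is the running passage number. [folklore] -/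
def discGo (idxs : List ℕ) (ov : Bool) : ℕ → List (ℕ × ℕ) → Bool
  | _, [] => true
  | n, (i, k) :: rest =>
    let isover : Bool := k == 1 || k == 3
    let c := countIdx idxs i
    let ok : Bool :=
      if c = 1 then isover == ov
      else if c = 2 then (if firstIdx idxs i = n then isover == !ov else isover == ov)
      else false
    ok && discGo idxs ov (n + 1) rest

/-- The distinct crossings of an arc in first-passage order, each with its surviving strand. [folklore] -/
def delsGo (idxs : List ℕ) : List (ℕ × ℕ) → List ℕ → List (ℕ × Keep) → List (ℕ × Keep)
  | [], _, acc => acc.reverse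
  | (i, k) :: rest, seen, acc =>
    if seen.any (· == i) then delsGo idxs rest seen acc
    else
      let kp : Keep := if countIdx idxs i = 2 then .neither
        else if (k == 1 || k == 3) then .lower else .upper
      delsGo idxs rest (i :: seen) ((i, kp) :: acc)

/-- A cut-open state: crossings, loose count, fresh counter, and the labels ending at `P` / starting at
`Q`. [folklore] -/
structure Cut where
  /-- crossings -/
  xs : List Xg
  /-- loose circles -/
  loose : ℕ
  /-- next fresh label -/
  fresh : ℕ
  /-- label of the edge whose head is the end vertex `P` -/
  pe : ℕ
  /-- label of the edge whose tail is the end vertex `Q` -/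
  qe : ℕ
  deriving DecidableEq, Repr

/-- Cut the arc strictly between `es` and `et` (mode `over`/under, monotone discipline) out of the
diagram: its crossings are deleted (other strands merged), `es` now ends at `P` and `et` starts at `Q`;
for `es = et` the edge is split at an interior point (the `Q` part gets a fresh label).  The rest of the
component must keep a crossing. [folklore] -/
def cutArc (st : St) (es et : ℕ) (ov : Bool) : Option Cut :=
  match findEnd st.xs es true 0, findEnd st.xs et false 0 with
  | some (i, k, _), some _ =>
    if es = et then some ⟨setSlot st.xs i k st.fresh, st.loose, st.fresh + 1, es, st.fresh⟩
    else
      match arcBetween st.xs es et with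
      | none => none
      | some ps =>
        let idxs := ps.map Prod.fst
        if !(discGo idxs ov 0 ps) then none
        else
          let r := deleteCrossings st.xs (delsGo idxs ps [] []) es et
          let xs2 := r.1
          let pe := r.2.2.1
          let qe := r.2.2.2
          if countLab xs2 pe = 1 ∧ countLab xs2 qe = 1 ∧ pe ≠ qe then
            some ⟨xs2, st.loose + r.2.1, st.fresh, pe, qe⟩
          else none
  | _, _ => none

/-- Extend the growing arc (tip edge `tip`, head at `P`) across dart `(y, fwd)` as the `over`/under
strand: `y` is cut at a new crossing (its second half gets label `fresh`, the arc continues with label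
`fresh + 1`, the crossing is appended). Returns the new cut state and tip. [folklore] -/
def insertCrossing (cs : Cut) (tip y : ℕ) (fwd ov : Bool) : Option (Cut × ℕ) :=
  match findEnd cs.xs y true 0 with
  | none => none
  | some (i, k, _) =>
    let y2 := cs.fresh
    let cont := cs.fresh + 1
    let nx : Xg :=
      if ov then (if fwd then ⟨y, tip, y2, cont, false⟩ else ⟨y, cont, y2, tip, true⟩)
      else (if fwd then ⟨tip, y2, cont, y, true⟩ else ⟨tip, y, cont, y2, false⟩)
    some (⟨setSlot cs.xs i k y2 ++ [nx], cs.loose, cs.fresh + 2, cont, cs.qe⟩, cont)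

/-- Route worker: cross the listed darts in order, each required to lie on the boundary of the face
currently containing the tip `P`, never crossing the new arc itself. [folklore] -/
def extendGo (ov : Bool) : List (ℕ × Bool) → Cut → ℕ → List ℕ → Option (Cut × ℕ)
  | [], cs, tip, _ => some (cs, tip)
  | (y, fwd) :: rest, cs, tip, arc =>
    if y = tip ∨ arc.any (· == y) then none
    else if !(sameFace cs.xs (some cs.pe) (some cs.qe) (tip, true) (y, fwd)) then none
    else
      match insertCrossing cs tip y fwd ov with
      | none => none
      | some (cs2, tip2) => extendGo ov rest cs2 tip2 (tip2 :: arc)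

/-- `PASS`: replace the arc between `es` and `et`, lying entirely above (`over = true`) or below the
rest, by the arc that leaves `P`, crosses the darts of `route` in order (same mode) and is sealed at `Q`,
which must lie in the face finally containing the tip. [folklore] -/
def pass (st : St) (ov : Bool) (es et : ℕ) (route : List (ℕ × Bool)) : Option St :=
  match cutArc st es et ov with
  | none => none
  | some cs =>
    match extendGo ov route cs cs.pe [cs.pe] with
    | none => none
    | some (cs2, tip) =>
      if !(sameFace cs2.xs (some cs2.pe) (some cs2.qe) (tip, true) (cs2.qe, true)) then none
      else if tip = cs2.qe then none
      else some ⟨relabelAll cs2.xs cs2.qe tip, cs2.loose, cs2.fresh⟩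

end Summit.Ventures.SP4Inv.KR
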